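/-
Copyright (c) 2026 the pub-hodgecm-mathlib formalisation cell (harness21).  Prover seat hodgecm-mathlib-K2E5-p16 (g5): Track B «K2-LIT»,
hLiu418 = stmt-HodgeConjecture-24832, ROAD Φ organ (SD-1-ind) step (V): LEVI EQUIVARIANCE of the archimedean Whittaker integral in the
tube frame (LEAD F0P6-plan (g13) DEAL BY NAME (V-L1)+(V-L2), 2026-09-04T09:46:01Z).
-/
import Summits.HodgeConjecture.HodgeConjecture.Theorems.K2LiuArchInducedTubeDefs          -- ★ (D∞): `IsArchSiegelSection`
import Summits.HodgeConjecture.HodgeConjecture.Theorems.K2LiuHermTwoConfluentXiDefs       -- ★ Φ6b-1: `hermTwo`, `xiTwoIntegrand`, `xiTwo`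
import Summits.HodgeConjecture.HodgeConjecture.Theorems.K2LiuHermTwoEtaDefs               -- ★ Φ6b-2: `hermTwo_add`, `hermTwo_smul`
import Mathlib.MeasureTheory.Measure.Lebesgue.EqHaar
import Mathlib.MeasureTheory.Measure.Haar.OfBasis
import Mathlib.Analysis.SpecialFunctions.Complex.Log
import Mathlib.LinearAlgebra.Matrix.Notation
import HarnessLib

/-!
# Crux `HLiu418`, ROAD Φ, organ (SD-1-ind) (V-L1)+(V-L2): Levi equivariance of the archimedean Whittaker integral (tube frame)

Cell `hodgecm-mathlib`, crux item hLiu418 = `stmt-HodgeConjecture-24832`, route of record `HCCMUnconditional`; squad K2, LEAD F0P6-plan (g13)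
(deal (V-L1)+(V-L2) for K2Liu-p05 (g4)'s (SD-1-ind) step (V)), prover K2E5-p16 (g5).  THEOREMS ONLY; lane `--supports stmt-HodgeConjecture-24832
--as helper`.

FRAME (★ H1-A `K2LiuHermitianTubeCocycle`, ★ (D∞) `K2LiuArchInducedTubeDefs`): `U(J)`, `J = (0 −1; 1 0)`, `n(x) = (1 x; 0 1)`, Levi elements
`m(a, d) = (a 0; 0 d)` with `aᴴ d = 1` (★ `levi_mem_iff`; `d = a⁻ᴴ`), Siegel sections `f (p g) = χ(det A_p) ‖det A_p‖^{2s+l} f g`.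
The Whittaker integral of a section `f` at `h` is `W_h(s; f) = ∫_{Herm₂} f (J n(x)) e(−tr(h x)) dx`, written — exactly as in ★ (IV-b)
`K2LiuKFiniteSectionXiIntegrandMoments.exists_xiTwoIntegrand_moments` — on the chart `x = hermTwo c`, `c : ℝ × ℂ × ℝ`, Lebesgue measure.

WHAT.
* §1 `integral_comp_hermTwo_conj` — the substitution `x ↦ a x aᴴ` on `Herm₂(ℂ) ≅ ℝ × ℂ × ℝ`: `∫ G (hermTwo c) dc = ‖det a‖⁴ • ∫ G (a (hermTwo c) aᴴ) dc`
  for EVERY `G` (no integrability needed; real Jacobian `‖det a‖⁴`, computed as `LinearMap.det` of the chart map `= (normSq (det a))²`).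
* §2 group letters (any `l`): `J m(a,d) = m(d,a) J`, `n(x) m(a,d) = m(a,d) n(dᴴ x d)`, hence for a Siegel section
  `f (J n(x) m(a,d)) = χ(det d) ‖det d‖^{2s+l} f (J n(dᴴ x d))` (`section_J_transl_levi`).
* §3 THE LEVI EQUIVARIANCE (`l = Fin 2`, `whittaker_levi_equivariance`): for `aᴴ d = 1`,
  `∫ f (J n(x) m(a,d)) e(−tr(h x)) dx = χ(det d) · ‖det a‖^{2 − 2s} · ∫ f (J n(x)) e(−tr((aᴴ h a) x)) dx`,
  i.e. `W_h(s; R(m(a,d)) f) = χ(det d) ‖det a‖^{2−2s} W_{aᴴ h a}(s; f)` (honest `c(s) = 2 − 2s`, character at `det d = (conj det a)⁻¹`).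
* §4 the same substitution at `ξ`-level (`xiTwo_levi`): `ξ(a g aᴴ, h; α, β) = ‖det a‖^{4 − 2α − 2β} ξ(g, aᴴ h a; α, β)` — principal branches are
  exactly equivariant since `det(a z aᴴ) = ‖det a‖² det z`; this is the `g`-slot form ★ (7d) `differentiableOn_iteratedDeriv_xiShift_param` consumes.
* §5 (V-L2) in the form the group side needs (`exists_conjTranspose_mul_add_mul_eq`): for `h` positive definite and `Y` hermitian there is `Ξ`
  with `Ξᴴ h + h Ξ = Y` (`Ξ = ½ h⁻¹ Y`; `a(t) = 1 + tΞ`), so the `h`-directions `d∕dt (a(t)ᴴ h a(t))|₀` exhaust `Herm₂`.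
HONEST LABEL.  Count-neutral helper of the K2_Liu road; it pays no socket by itself: `HC_CM` is proved only modulo the 7 printed citations
(2 remaining named inputs: hLiu418 = `stmt-HodgeConjecture-24832`, h413 = `stmt-HodgeConjecture-24833`) until rung 0 closes.
References: [Shimura1997, §16]; G. Shimura, Math. Ann. 260 (1982), (1.17), (3.2) (the substitution `x ↦ a x aᴴ`; proofs here are from first principles).
-/

set_option autoImplicit false
-- the mandated namespace repeats the single-problem summit's segment (`HodgeConjecture.HodgeConjecture`)
set_option linter.dupNamespace false

noncomputable section

open Complex MeasureTheory Matrix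
open scoped ComplexOrder ComplexConjugate Matrix

namespace Summit.HodgeConjecture.HodgeConjecture.Cruxes.HLiu418.K2LiuArchWhittakerLeviEquivariance

open Summit.HodgeConjecture.HodgeConjecture.Cruxes.HLiu418.K2LiuHermTwoGammaDefs
open Summit.HodgeConjecture.HodgeConjecture.Cruxes.HLiu418.K2LiuHermTwoConfluentXiDefs
open Summit.HodgeConjecture.HodgeConjecture.Cruxes.HLiu418.K2LiuHermTwoEtaDefs (hermTwo_add hermTwo_smul)
open Summit.HodgeConjecture.HodgeConjecture.Cruxes.HLiu418.K2LiuArchInducedTubeDefs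

/-! ## §1 The substitution `x ↦ a x aᴴ` on `Herm₂(ℂ) ≅ ℝ × ℂ × ℝ` -/

/-- `a x aᴴ` is hermitian for hermitian `x = hermTwo c`. [folklore] -/
theorem isHermitian_conj_hermTwo (a : Matrix (Fin 2) (Fin 2) ℂ) (c : ℝ × ℂ × ℝ) : (a * hermTwo c * aᴴ).IsHermitian := by
  have h := Matrix.isHermitian_conjTranspose_mul_mul aᴴ (isHermitian_hermTwo c)
  rwa [conjTranspose_conjTranspose] at h

/-- The chart of `a x aᴴ`: `hermTwo (re (a x aᴴ)₀₀, (a x aᴴ)₀₁, re (a x aᴴ)₁₁) = a x aᴴ`. [folklore] -/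
theorem hermTwo_chart_conj (a : Matrix (Fin 2) (Fin 2) ℂ) (c : ℝ × ℂ × ℝ) :
    hermTwo (((a * hermTwo c * aᴴ) 0 0).re, (a * hermTwo c * aᴴ) 0 1, ((a * hermTwo c * aᴴ) 1 1).re) = a * hermTwo c * aᴴ :=
  hermTwo_eq_of_isHermitian (isHermitian_conj_hermTwo a c)

/-- `det (a x aᴴ) = ‖det a‖² · det x`. [folklore] -/
theorem det_conj_eq (a x : Matrix (Fin 2) (Fin 2) ℂ) : (a * x * aᴴ).det = ((‖a.det‖ ^ 2 : ℝ) : ℂ) * x.det := by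
  rw [det_mul, det_mul, det_conjTranspose, Complex.star_def, Complex.sq_norm, Complex.normSq_eq_conj_mul_self]
  ring

/-- **THE JACOBIAN.**  For `a ∈ GL₂(ℂ)` and every `G`, `∫ G (hermTwo c) dc = ‖det a‖⁴ • ∫ G (a · hermTwo c · aᴴ) dc` (Lebesgue measure on
`ℝ × ℂ × ℝ`; both sides are `0` together when `G ∘ hermTwo` is not integrable).  The chart map `c ↦ chart(a · hermTwo c · aᴴ)` is real-linear
with determinant `(normSq (det a))² = ‖det a‖⁴`. [cite: Shimura1997, §16.4] (Shimura 1982, Math. Ann. 260, (1.17)) -/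
theorem integral_comp_hermTwo_conj {F : Type*} [NormedAddCommGroup F] [NormedSpace ℝ F] {a : Matrix (Fin 2) (Fin 2) ℂ} (ha : a.det ≠ 0)
    (G : Matrix (Fin 2) (Fin 2) ℂ → F) :
    ∫ c : ℝ × ℂ × ℝ, G (hermTwo c) = (‖a.det‖ ^ 4 : ℝ) • ∫ c : ℝ × ℂ × ℝ, G (a * hermTwo c * aᴴ) := by
  -- the chart map as a real-linear endomorphism of `ℝ × ℂ × ℝ`
  let Φ : (ℝ × ℂ × ℝ) →ₗ[ℝ] (ℝ × ℂ × ℝ) :=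
    { toFun := fun c => (((a * hermTwo c * aᴴ) 0 0).re, (a * hermTwo c * aᴴ) 0 1, ((a * hermTwo c * aᴴ) 1 1).re)
      map_add' := fun c c' => by
        simp only [hermTwo_add, Matrix.mul_add, Matrix.add_mul, Matrix.add_apply, Complex.add_re, Prod.mk_add_mk]
      map_smul' := fun r c => by
        simp only [hermTwo_smul, Matrix.mul_smul, Matrix.smul_mul, Matrix.smul_apply, smul_eq_mul, RingHom.id_apply, Prod.smul_mk,
          Complex.real_smul, Complex.re_ofReal_mul] }
  have hΦ : ∀ c, hermTwo (Φ c) = a * hermTwo c * aᴴ := fun c => hermTwo_chart_conj a c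
  -- real coordinates `(u, re z, im z, v)` and the matrix of `Φ`
  let ψ : (ℝ × ℂ × ℝ) ≃ₗ[ℝ] (Fin 4 → ℝ) :=
    { toFun := fun c => ![c.1, c.2.1.re, c.2.1.im, c.2.2]
      map_add' := fun c c' => by ext i; fin_cases i <;> simp
      map_smul' := fun r c => by ext i; fin_cases i <;> simp
      invFun := fun v => (v 0, ⟨v 1, v 2⟩, v 3)
      left_inv := fun c => by simp
      right_inv := fun v => by ext i; fin_cases i <;> simp }
  let b : Module.Basis (Fin 4) ℝ (ℝ × ℂ × ℝ) := Module.Basis.ofEquivFun ψ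
  have hdet : LinearMap.det Φ = (normSq a.det) ^ 2 := by
    rw [← LinearMap.det_toMatrix b]
    have hM : LinearMap.toMatrix b b Φ = !![
        (a 0 0).re ^ 2 + (a 0 0).im ^ 2, 2 * ((a 0 0).re * (a 0 1).re + (a 0 0).im * (a 0 1).im),
          -2 * ((a 0 0).im * (a 0 1).re - (a 0 0).re * (a 0 1).im), (a 0 1).re ^ 2 + (a 0 1).im ^ 2;
        (a 0 0).re * (a 1 0).re + (a 0 0).im * (a 1 0).im,
          ((a 0 0).re * (a 1 1).re + (a 0 0).im * (a 1 1).im) + ((a 0 1).re * (a 1 0).re + (a 0 1).im * (a 1 0).im),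
          -((a 0 0).im * (a 1 1).re - (a 0 0).re * (a 1 1).im) + ((a 0 1).im * (a 1 0).re - (a 0 1).re * (a 1 0).im),
          (a 0 1).re * (a 1 1).re + (a 0 1).im * (a 1 1).im;
        (a 0 0).im * (a 1 0).re - (a 0 0).re * (a 1 0).im,
          ((a 0 0).im * (a 1 1).re - (a 0 0).re * (a 1 1).im) + ((a 0 1).im * (a 1 0).re - (a 0 1).re * (a 1 0).im),
          ((a 0 0).re * (a 1 1).re + (a 0 0).im * (a 1 1).im) - ((a 0 1).re * (a 1 0).re + (a 0 1).im * (a 1 0).im),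
          (a 0 1).im * (a 1 1).re - (a 0 1).re * (a 1 1).im;
        (a 1 0).re ^ 2 + (a 1 0).im ^ 2, 2 * ((a 1 0).re * (a 1 1).re + (a 1 0).im * (a 1 1).im),
          -2 * ((a 1 0).im * (a 1 1).re - (a 1 0).re * (a 1 1).im), (a 1 1).re ^ 2 + (a 1 1).im ^ 2] := by
      ext i j
      rw [LinearMap.toMatrix_apply, Module.Basis.ofEquivFun_repr_apply, Module.Basis.coe_ofEquivFun]
      fin_cases i <;> fin_cases j <;>
        simp [Φ, ψ, Matrix.mul_apply, Fin.sum_univ_two, hermTwo, Matrix.conjTranspose_apply] <;> ring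
    rw [hM]
    have hd : a.det = a 0 0 * a 1 1 - a 0 1 * a 1 0 := Matrix.det_fin_two a
    rw [hd, Complex.normSq_apply]
    simp [Matrix.det_succ_row_zero, Fin.sum_univ_succ, Fin.succAbove]
    ring
  have hdet0 : LinearMap.det Φ ≠ 0 := by
    rw [hdet]; exact pow_ne_zero _ ((Complex.normSq_pos.2 ha).ne')
  -- change of variables for the linear equivalence `Φ`
  let Φe : (ℝ × ℂ × ℝ) ≃ₗ[ℝ] (ℝ × ℂ × ℝ) := LinearMap.equivOfDetNeZero Φ hdet0
  have hΦe : ∀ c, Φe c = Φ c := fun c => rfl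
  haveI : (volume : Measure (ℂ × ℝ)).IsAddHaarMeasure := Measure.prod.instIsAddHaarMeasure _ _
  haveI : (volume : Measure (ℝ × ℂ × ℝ)).IsAddHaarMeasure := Measure.prod.instIsAddHaarMeasure _ _
  have hmap : Measure.map Φ volume = ENNReal.ofReal |(LinearMap.det Φ)⁻¹| • (volume : Measure (ℝ × ℂ × ℝ)) :=
    Measure.map_linearMap_addHaar_eq_smul_addHaar volume hdet0
  have h1 : ∫ c : ℝ × ℂ × ℝ, G (a * hermTwo c * aᴴ) = ∫ c : ℝ × ℂ × ℝ, (G ∘ hermTwo) (Φe.toContinuousLinearEquiv.toHomeomorph.toMeasurableEquiv c) := by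
    refine integral_congr_ae (Filter.Eventually.of_forall fun c => ?_)
    simp only [Function.comp_apply, Homeomorph.toMeasurableEquiv_coe, ContinuousLinearEquiv.coe_toHomeomorph,
      LinearEquiv.coe_toContinuousLinearEquiv', hΦe, hΦ]
  have hcoe : (⇑(Φe.toContinuousLinearEquiv.toHomeomorph.toMeasurableEquiv) : (ℝ × ℂ × ℝ) → ℝ × ℂ × ℝ) = ⇑Φ := by
    funext c
    simp only [Homeomorph.toMeasurableEquiv_coe, ContinuousLinearEquiv.coe_toHomeomorph, LinearEquiv.coe_toContinuousLinearEquiv', hΦe]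
  rw [h1, ← integral_map_equiv, hcoe, hmap, integral_smul_measure, hdet, ENNReal.toReal_ofReal (abs_nonneg _), abs_inv,
    abs_of_nonneg (sq_nonneg _), smul_smul, Complex.normSq_eq_norm_sq]
  rw [show ‖a.det‖ ^ 4 * ((‖a.det‖ ^ 2) ^ 2)⁻¹ = 1 by field_simp [norm_ne_zero_iff.2 ha], one_smul]
  rfl

/-! ## §2 Group letters: `J`, translations and Levi elements (any `l`) -/

section Letters

variable {l : Type*} [Fintype l] [DecidableEq l]

/-- `J · m(a, d) = m(d, a) · J`. [cite: Shimura1997, §5.1] -/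
theorem J_mul_levi (a d : Matrix l l ℂ) :
    Matrix.J l ℂ * fromBlocks a 0 0 d = fromBlocks d 0 0 a * Matrix.J l ℂ := by
  rw [Matrix.J, fromBlocks_multiply, fromBlocks_multiply]
  simp

/-- From `aᴴ d = 1`: `d aᴴ = 1`, `a dᴴ = 1`, `dᴴ a = 1`. [folklore] -/
theorem levi_inverse_letters {a d : Matrix l l ℂ} (had : aᴴ * d = 1) : d * aᴴ = 1 ∧ a * dᴴ = 1 ∧ dᴴ * a = 1 := by
  have hda : d * aᴴ = 1 := mul_eq_one_comm.1 had
  refine ⟨hda, ?_, ?_⟩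
  · have h := congrArg conjTranspose hda
    rwa [conjTranspose_mul, conjTranspose_conjTranspose, conjTranspose_one] at h
  · have h := congrArg conjTranspose had
    rwa [conjTranspose_mul, conjTranspose_conjTranspose, conjTranspose_one] at h

/-- `n(x) · m(a, d) = m(a, d) · n(dᴴ x d)` for `aᴴ d = 1`. [cite: Shimura1997, §5.1] -/
theorem transl_mul_levi {a d : Matrix l l ℂ} (had : aᴴ * d = 1) (x : Matrix l l ℂ) :
    fromBlocks 1 x 0 1 * fromBlocks a 0 0 d = fromBlocks a 0 0 d * fromBlocks 1 (dᴴ * x * d) 0 1 := by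
  obtain ⟨-, had', -⟩ := levi_inverse_letters had
  rw [fromBlocks_multiply, fromBlocks_multiply]
  simp only [Matrix.one_mul, Matrix.mul_one, Matrix.mul_zero, Matrix.zero_mul, add_zero, zero_add]
  rw [← Matrix.mul_assoc, ← Matrix.mul_assoc, had', Matrix.one_mul]

/-- `J · n(x) · m(a, d) = m(d, a) · (J · n(dᴴ x d))` for `aᴴ d = 1`. [cite: Shimura1997, §5.1] -/
theorem J_mul_transl_mul_levi {a d : Matrix l l ℂ} (had : aᴴ * d = 1) (x : Matrix l l ℂ) :
    Matrix.J l ℂ * fromBlocks 1 x 0 1 * fromBlocks a 0 0 d = fromBlocks d 0 0 a * (Matrix.J l ℂ * fromBlocks 1 (dᴴ * x * d) 0 1) := by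
  rw [Matrix.mul_assoc, transl_mul_levi had, ← Matrix.mul_assoc, J_mul_levi, Matrix.mul_assoc]

/-- `m(d, a) ∈ U(J)` when `aᴴ d = 1`. [cite: Shimura1997, §5.1] -/
theorem levi_mem {a d : Matrix l l ℂ} (had : aᴴ * d = 1) :
    (fromBlocks d 0 0 a : Matrix (l ⊕ l) (l ⊕ l) ℂ)ᴴ * Matrix.J l ℂ * fromBlocks d 0 0 a = Matrix.J l ℂ :=
  (K2LiuHermitianTubeCocycle.levi_mem_iff d a).2 (levi_inverse_letters had).2.2

/-- Right translates of Siegel sections are Siegel sections (same `χ`, `s`). [cite: Shimura1997, §16] -/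
theorem isArchSiegelSection_rightTranslate {χ : ℂ → ℂ} {s : ℂ} {f : Matrix (l ⊕ l) (l ⊕ l) ℂ → ℂ} (hf : IsArchSiegelSection χ s f)
    (m : Matrix (l ⊕ l) (l ⊕ l) ℂ) : IsArchSiegelSection χ s (fun g => f (g * m)) := by
  intro p g hP hp
  simp only
  rw [Matrix.mul_assoc]
  exact hf p (g * m) hP hp

/-- **A Siegel section at `J · n(x) · m(a, d)`**: `f (J n(x) m(a,d)) = χ(det d) · ‖det d‖^{2s + l} · f (J n(dᴴ x d))` (`aᴴ d = 1`).
[cite: Shimura1997, §16] -/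
theorem section_J_transl_levi {χ : ℂ → ℂ} {s : ℂ} {f : Matrix (l ⊕ l) (l ⊕ l) ℂ → ℂ} (hf : IsArchSiegelSection χ s f)
    {a d : Matrix l l ℂ} (had : aᴴ * d = 1) (x : Matrix l l ℂ) :
    f (Matrix.J l ℂ * fromBlocks 1 x 0 1 * fromBlocks a 0 0 d) =
      χ d.det * (((‖d.det‖ : ℝ) : ℂ) ^ (2 * s + (Fintype.card l : ℂ))) * f (Matrix.J l ℂ * fromBlocks 1 (dᴴ * x * d) 0 1) := by
  rw [J_mul_transl_mul_levi had]
  have h := hf (fromBlocks d 0 0 a) (Matrix.J l ℂ * fromBlocks 1 (dᴴ * x * d) 0 1) (levi_mem had) (toBlocks_fromBlocks₂₁ d 0 0 a)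
  rwa [toBlocks_fromBlocks₁₁] at h

/-- Determinant letters: for `aᴴ d = 1`, `det a ≠ 0` and `‖det d‖ = ‖det a‖⁻¹`. [folklore] -/
theorem norm_det_levi {a d : Matrix l l ℂ} (had : aᴴ * d = 1) : a.det ≠ 0 ∧ ‖d.det‖ = ‖a.det‖⁻¹ := by
  have h := congrArg Matrix.det had
  rw [det_mul, det_conjTranspose, det_one] at h
  have hn : ‖a.det‖ * ‖d.det‖ = 1 := by
    rw [← norm_star, ← norm_mul, h, norm_one]
  have ha : ‖a.det‖ ≠ 0 := fun h0 => by rw [h0, zero_mul] at hn; exact zero_ne_one hn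
  exact ⟨norm_ne_zero_iff.1 ha, by field_simp; linarith⟩

end Letters

/-! ## §3 The Levi equivariance of the Whittaker integral (`l = Fin 2`) -/

/-- Scalar bookkeeping: `(r⁻¹)^{2s+2} · r⁴ = r^{2−2s}` for `r > 0` (principal powers of positive reals). [folklore] -/
theorem levi_scalar {r : ℝ} (hr : 0 < r) (s : ℂ) :
    ((r⁻¹ : ℝ) : ℂ) ^ (2 * s + 2) * ((r ^ 4 : ℝ) : ℂ) = (r : ℂ) ^ (2 - 2 * s) := by
  have hr0 : (r : ℂ) ≠ 0 := ofReal_ne_zero.2 hr.ne'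
  have hri : ((r⁻¹ : ℝ) : ℂ) ≠ 0 := ofReal_ne_zero.2 (inv_ne_zero hr.ne')
  have h4 : ((r ^ 4 : ℝ) : ℂ) = cexp (4 * Real.log r) := by
    rw [show (4 : ℂ) * Real.log r = ((4 : ℕ) : ℂ) * Real.log r by norm_num, Complex.exp_nat_mul, ← ofReal_exp, Real.exp_log hr]
    push_cast; ring
  rw [cpow_def_of_ne_zero hri, cpow_def_of_ne_zero hr0, ← ofReal_log hr.le, ← ofReal_log (inv_pos.2 hr).le, Real.log_inv, h4,
    ← Complex.exp_add]
  push_cast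
  ring_nf

/-- Trace letter: `tr(h · a x aᴴ) = tr(aᴴ h a · x)`. [folklore] -/
theorem trace_mul_conj (h a x : Matrix (Fin 2) (Fin 2) ℂ) : (h * (a * x * aᴴ)).trace = (aᴴ * h * a * x).trace := by
  rw [show h * (a * x * aᴴ) = (h * a) * x * aᴴ by simp only [Matrix.mul_assoc], Matrix.trace_mul_cycle, ← Matrix.mul_assoc]

/-- **LEVI EQUIVARIANCE OF THE ARCHIMEDEAN WHITTAKER INTEGRAL (tube frame, `U(2,2)`).**  For a Siegel section `f` of `I_w(s, χ)`, a Levi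
element `m(a, d) = (a 0; 0 d)` of `U(J)` (`aᴴ d = 1`, i.e. `d = a⁻ᴴ`) and any `h`,
`∫ f (J n(x) m(a,d)) e(−tr(h x)) dx = χ(det d) · ‖det a‖^{2 − 2s} · ∫ f (J n(x)) e(−tr((aᴴ h a) x)) dx`
(`x = hermTwo c`, Lebesgue measure on `ℝ × ℂ × ℝ`; no integrability hypothesis — both sides vanish together otherwise), i.e.
`W_h(s; R(m(a,d)) f) = χ(det d) ‖det a‖^{2−2s} W_{aᴴ h a}(s; f)`: the section law at `m(d, a)` gives `χ(det d) ‖det d‖^{2s+2}`, the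
substitution `x ↦ a x aᴴ` the Jacobian `‖det a‖⁴`, and `‖det d‖ = ‖det a‖⁻¹`. [cite: Shimura1997, §16] (Shimura 1982, Math. Ann. 260, (3.2)) -/
theorem whittaker_levi_equivariance {χ : ℂ → ℂ} {s : ℂ} {f : Matrix (Fin 2 ⊕ Fin 2) (Fin 2 ⊕ Fin 2) ℂ → ℂ} (hf : IsArchSiegelSection χ s f)
    {a d : Matrix (Fin 2) (Fin 2) ℂ} (had : aᴴ * d = 1) (h : Matrix (Fin 2) (Fin 2) ℂ) :
    ∫ c : ℝ × ℂ × ℝ, f (Matrix.J (Fin 2) ℂ * fromBlocks 1 (hermTwo c) 0 1 * fromBlocks a 0 0 d) * cexp (-(2 * Real.pi * I) * (h * hermTwo c).trace) =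
      χ d.det * ((‖a.det‖ : ℝ) : ℂ) ^ (2 - 2 * s) *
        ∫ c : ℝ × ℂ × ℝ, f (Matrix.J (Fin 2) ℂ * fromBlocks 1 (hermTwo c) 0 1) * cexp (-(2 * Real.pi * I) * (aᴴ * h * a * hermTwo c).trace) := by
  obtain ⟨ha, hnd⟩ := norm_det_levi had
  obtain ⟨-, -, hda⟩ := levi_inverse_letters had
  have hcard : (Fintype.card (Fin 2) : ℂ) = 2 := by simp
  -- the section law at `m(d, a)`, pointwise
  have step1 : ∀ c : ℝ × ℂ × ℝ,
      f (Matrix.J (Fin 2) ℂ * fromBlocks 1 (hermTwo c) 0 1 * fromBlocks a 0 0 d) * cexp (-(2 * Real.pi * I) * (h * hermTwo c).trace) =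
        χ d.det * ((‖d.det‖ : ℝ) : ℂ) ^ (2 * s + 2) *
          ((fun X : Matrix (Fin 2) (Fin 2) ℂ => f (Matrix.J (Fin 2) ℂ * fromBlocks 1 (dᴴ * X * d) 0 1) * cexp (-(2 * Real.pi * I) * (h * X).trace))
            (hermTwo c)) := fun c => by
    simp only
    rw [section_J_transl_levi hf had, hcard]
    ring
  -- the substitution `x ↦ a x aᴴ`
  have step2 := integral_comp_hermTwo_conj ha
    (fun X : Matrix (Fin 2) (Fin 2) ℂ => f (Matrix.J (Fin 2) ℂ * fromBlocks 1 (dᴴ * X * d) 0 1) * cexp (-(2 * Real.pi * I) * (h * X).trace))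
  have step3 : ∀ c : ℝ × ℂ × ℝ,
      (fun X : Matrix (Fin 2) (Fin 2) ℂ => f (Matrix.J (Fin 2) ℂ * fromBlocks 1 (dᴴ * X * d) 0 1) * cexp (-(2 * Real.pi * I) * (h * X).trace))
          (a * hermTwo c * aᴴ) =
        f (Matrix.J (Fin 2) ℂ * fromBlocks 1 (hermTwo c) 0 1) * cexp (-(2 * Real.pi * I) * (aᴴ * h * a * hermTwo c).trace) := fun c => by
    simp only
    rw [show dᴴ * (a * hermTwo c * aᴴ) * d = (dᴴ * a) * hermTwo c * (aᴴ * d) by simp only [Matrix.mul_assoc], hda, had, Matrix.one_mul,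
      Matrix.mul_one, trace_mul_conj]
  simp_rw [step3] at step2
  rw [integral_congr_ae (Filter.Eventually.of_forall step1), integral_const_mul, step2, Complex.real_smul, ← mul_assoc, hnd,
    mul_assoc (χ d.det), levi_scalar (norm_pos_iff.2 ha)]

/-! ## §4 The same substitution at `ξ`-level -/

/-- `(r · w)^z = r^z · w^z` for a real `r > 0` (principal branch). [folklore] -/
theorem ofReal_mul_cpow {r : ℝ} (hr : 0 < r) (w z : ℂ) : ((r : ℂ) * w) ^ z = (r : ℂ) ^ z * w ^ z := by
  have hr0 : (r : ℂ) ≠ 0 := ofReal_ne_zero.2 hr.ne'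
  rcases eq_or_ne w 0 with rfl | hw
  · rcases eq_or_ne z 0 with rfl | hz
    · simp
    · rw [mul_zero, zero_cpow hz, mul_zero]
  · rw [cpow_def_of_ne_zero (mul_ne_zero hr0 hw), cpow_def_of_ne_zero hr0, cpow_def_of_ne_zero hw, Complex.log_ofReal_mul hr hw, add_mul,
      Complex.exp_add, ofReal_log hr.le]

/-- Scalar bookkeeping: `r⁴ · (r²)^{−α} · (r²)^{−β} = r^{4 − 2α − 2β}` for `r > 0`. [folklore] -/
theorem levi_scalar_xi {r : ℝ} (hr : 0 < r) (α β : ℂ) :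
    ((r ^ 4 : ℝ) : ℂ) * ((((r ^ 2 : ℝ) : ℂ) ^ (-α)) * (((r ^ 2 : ℝ) : ℂ) ^ (-β))) = (r : ℂ) ^ (4 - 2 * α - 2 * β) := by
  have hr0 : (r : ℂ) ≠ 0 := ofReal_ne_zero.2 hr.ne'
  have hr2 : ((r ^ 2 : ℝ) : ℂ) ≠ 0 := ofReal_ne_zero.2 (pow_ne_zero _ hr.ne')
  have h4 : ((r ^ 4 : ℝ) : ℂ) = cexp (4 * Real.log r) := by
    rw [show (4 : ℂ) * Real.log r = ((4 : ℕ) : ℂ) * Real.log r by norm_num, Complex.exp_nat_mul, ← ofReal_exp, Real.exp_log hr]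
    push_cast; ring
  rw [cpow_def_of_ne_zero hr2, cpow_def_of_ne_zero hr2, cpow_def_of_ne_zero hr0, ← ofReal_log hr.le, ← ofReal_log (pow_pos hr 2).le,
    Real.log_pow, h4, ← Complex.exp_add, ← Complex.exp_add]
  push_cast
  ring_nf

/-- **LEVI EQUIVARIANCE OF `ξ`**: `ξ(a g aᴴ, h; α, β) = ‖det a‖^{4 − 2α − 2β} · ξ(g, aᴴ h a; α, β)` for `a ∈ GL₂(ℂ)` and ALL `g, h, α, β`
(principal branches are exactly equivariant: `det(a z aᴴ) = ‖det a‖² det z` is a positive multiple).  The `h`-variation of `ξ(g, ·)`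
along `a(t)ᴴ h a(t)` is thus the `g`-variation along `a(t) g a(t)ᴴ` — the slot of ★ (7d). [cite: Shimura1997, §16.4] (Shimura 1982, Math. Ann. 260, (3.2)) -/
theorem xiTwo_levi {a : Matrix (Fin 2) (Fin 2) ℂ} (ha : a.det ≠ 0) (g h : Matrix (Fin 2) (Fin 2) ℂ) (α β : ℂ) :
    xiTwo (a * g * aᴴ) h α β = ((‖a.det‖ : ℝ) : ℂ) ^ (4 - 2 * α - 2 * β) * xiTwo g (aᴴ * h * a) α β := by
  have hr : 0 < ‖a.det‖ := norm_pos_iff.2 ha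
  have hr2 : 0 < ‖a.det‖ ^ 2 := pow_pos hr 2
  -- `ξ(a g aᴴ, h)` as `∫ G (hermTwo c)`
  have step1 : xiTwo (a * g * aᴴ) h α β = ∫ c : ℝ × ℂ × ℝ,
      (fun X : Matrix (Fin 2) (Fin 2) ℂ => cexp (-(2 * Real.pi * I) * (h * X).trace) *
        ((cexp (-(Real.pi * I) * α) * (a * g * aᴴ - I • X).det ^ (-α)) * (cexp ((Real.pi * I) * β) * (a * g * aᴴ + I • X).det ^ (-β))))
        (hermTwo c) := rfl
  have step2 := integral_comp_hermTwo_conj ha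
    (fun X : Matrix (Fin 2) (Fin 2) ℂ => cexp (-(2 * Real.pi * I) * (h * X).trace) *
      ((cexp (-(Real.pi * I) * α) * (a * g * aᴴ - I • X).det ^ (-α)) * (cexp ((Real.pi * I) * β) * (a * g * aᴴ + I • X).det ^ (-β))))
  have step3 : ∀ c : ℝ × ℂ × ℝ,
      (fun X : Matrix (Fin 2) (Fin 2) ℂ => cexp (-(2 * Real.pi * I) * (h * X).trace) *
        ((cexp (-(Real.pi * I) * α) * (a * g * aᴴ - I • X).det ^ (-α)) * (cexp ((Real.pi * I) * β) * (a * g * aᴴ + I • X).det ^ (-β))))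
          (a * hermTwo c * aᴴ) =
        (((‖a.det‖ ^ 2 : ℝ) : ℂ) ^ (-α) * ((‖a.det‖ ^ 2 : ℝ) : ℂ) ^ (-β)) * xiTwoIntegrand g (aᴴ * h * a) α β c := fun c => by
    simp only
    rw [xiTwoIntegrand_apply, trace_mul_conj,
      show a * g * aᴴ - I • (a * hermTwo c * aᴴ) = a * (g - I • hermTwo c) * aᴴ by
        rw [Matrix.mul_sub, Matrix.sub_mul, Matrix.mul_smul, Matrix.smul_mul],
      show a * g * aᴴ + I • (a * hermTwo c * aᴴ) = a * (g + I • hermTwo c) * aᴴ by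
        rw [Matrix.mul_add, Matrix.add_mul, Matrix.mul_smul, Matrix.smul_mul],
      det_conj_eq, det_conj_eq, ofReal_mul_cpow hr2, ofReal_mul_cpow hr2]
    ring
  simp_rw [step3] at step2
  rw [step1, step2, integral_const_mul, Complex.real_smul, ← mul_assoc, levi_scalar_xi hr, ← xiTwo_def]

/-! ## §5 (V-L2) The `h`-directions `Ξᴴ h + h Ξ` exhaust the hermitian matrices -/

/-- **(V-L2)** For `h` positive definite and `Y` hermitian there is `Ξ` with `Ξᴴ h + h Ξ = Y` (`Ξ = ½ h⁻¹ Y`).  Hence along `a(t) = 1 + tΞ ∈ GL(ℂ)`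
(`t` real, small) `a(t)ᴴ h a(t) = h + tY + t² Ξᴴ h Ξ` moves `h` in ANY hermitian direction `Y`: with §3∕§4 every first `h`-derivative of a
Whittaker integral ∕ of `ξ(g, ·)` is a derivative in the group ∕ `g`-slot. [folklore] -/
theorem exists_conjTranspose_mul_add_mul_eq {n : Type*} [Fintype n] [DecidableEq n] {h : Matrix n n ℂ} (hh : h.PosDef) {Y : Matrix n n ℂ}
    (hY : Yᴴ = Y) : ∃ Ξ : Matrix n n ℂ, Ξᴴ * h + h * Ξ = Y := by
  have hdet : IsUnit h.det := isUnit_iff_ne_zero.2 hh.det_pos.ne'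
  have hinv : (h⁻¹)ᴴ = h⁻¹ := hh.isHermitian.inv.eq
  refine ⟨(2 : ℂ)⁻¹ • (h⁻¹ * Y), ?_⟩
  rw [conjTranspose_smul, conjTranspose_mul, hY, hinv, Matrix.smul_mul, Matrix.mul_smul, Matrix.mul_assoc, Matrix.nonsing_inv_mul h hdet,
    Matrix.mul_one, ← Matrix.mul_assoc, Matrix.mul_nonsing_inv h hdet, Matrix.one_mul, ← add_smul]
  norm_num

/-- The curve letter: `(1 + t Ξ)ᴴ h (1 + t Ξ) = h + t (Ξᴴ h + h Ξ) + t² (Ξᴴ h Ξ)` for real `t`. [folklore] -/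
theorem conjTranspose_curve_mul {n : Type*} [Fintype n] [DecidableEq n] (h Ξ : Matrix n n ℂ) (t : ℝ) :
    (1 + (t : ℂ) • Ξ)ᴴ * h * (1 + (t : ℂ) • Ξ) = h + (t : ℂ) • (Ξᴴ * h + h * Ξ) + ((t : ℂ) ^ 2) • (Ξᴴ * h * Ξ) := by
  rw [conjTranspose_add, conjTranspose_one, conjTranspose_smul, Complex.star_def, Complex.conj_ofReal]
  simp only [Matrix.add_mul, Matrix.mul_add, Matrix.one_mul, Matrix.mul_one, Matrix.smul_mul, Matrix.mul_smul, smul_add, smul_smul, sq]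
  abel

end Summit.HodgeConjecture.HodgeConjecture.Cruxes.HLiu418.K2LiuArchWhittakerLeviEquivariance

end
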